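import Mathlib
import Summits.Ventures.PercRepro2.Defs
import Summits.Ventures.PercRepro2.Graph
import Summits.Ventures.PercRepro2.OneColourSwitch
import Summits.Ventures.PercRepro2.RegionHubSign
import Summits.Ventures.PercRepro2.SideSwitch
import Summits.Ventures.PercRepro2.SideSwitchFibre
import Summits.Ventures.PercRepro2.SideSwitchMono

/-!
# `m9` by side switches: one Harris inequality on the hypercube of side assignments
(blind cell PercRepro2, p3 g18, 2026-08-27; `proofs/P3-CPNC.md` §15)

On the class in which no two non-marks are adjacent and no non-mark lies in both worlds of
`{r, s}` (`NoNonmarkEdge`, `DZero` — e.g. every non-mark adjacent to `p` or `q`), the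
`Sep`-colourings are fibred over the representatives `ρ` by the hypercube `2^{A0}` of side
assignments (`SideSwitchFibre`), and on each fibre
`σ_pq(ρ_T) + σ_pq(ρ^O_T) = G(T) − G(A0 ∖ T)` with `G` increasing (`sigma_pq_add_flipO`) and
`σ_rs(ρ_T)` decreasing in `T` (`SideSwitchMono`).  Harris' inequality on the uniform hypercube
(`harris_powerset`, by induction on `A0`) with `Σ_T (G(T) − G(A0 ∖ T)) = 0` gives the per-fibre
sum `≤ 0`, hence `Σ_{Sep} σ_pq · σ_rs ≤ 0` (`m9SignSum_nonpos_of_noNonmarkEdge`); the class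
«every non-mark adjacent to `p` or `q`, no two non-marks adjacent» is
`m9SignSum_nonpos_of_adj`.  This is the second proof of the class theorem of
`proofs/P3-CPNC.md` §14i (there: the region identity and the side pairing), in the sub-class
where the components of `G[A0]` are single vertices.  Own work; std axioms.
-/

namespace Summit.Ventures.PercRepro2

namespace SideSwitch

open Finset Classical RegionHub OneColourSwitch

variable {V : Type*} {E : Type*}
variable {ends : E → Sym2 V}

section Count

variable [Fintype V] [DecidableEq V] [Fintype E] [DecidableEq E]

/-! ## Harris on the hypercube of side assignments -/

omit [Fintype V] in
/-- **Harris' inequality on the hypercube `2^A`** (uniform measure, integer form): for `f, g`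
increasing on the subsets of `A`, `(Σ f)(Σ g) ≤ 2^{|A|} Σ f g`. -/
lemma harris_powerset (A : Finset V) : ∀ (f g : Finset V → ℤ),
    (∀ T T', T ⊆ T' → T' ⊆ A → f T ≤ f T') → (∀ T T', T ⊆ T' → T' ⊆ A → g T ≤ g T') →
    (∑ T ∈ A.powerset, f T) * (∑ T ∈ A.powerset, g T) ≤
      2 ^ A.card * ∑ T ∈ A.powerset, f T * g T := by
  induction A using Finset.induction_on with
  | empty =>
    intro f g _ _
    simp
  | @insert a A' ha ih =>
    intro f g hf hg
    rw [Finset.sum_powerset_insert ha, Finset.sum_powerset_insert ha,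
      Finset.sum_powerset_insert ha, Finset.card_insert_of_notMem ha, pow_succ]
    have hsub : A' ⊆ insert a A' := Finset.subset_insert a A'
    have h0 := ih f g (fun T T' h1 h2 => hf T T' h1 (h2.trans hsub))
      (fun T T' h1 h2 => hg T T' h1 (h2.trans hsub))
    have h1 := ih (fun T => f (insert a T)) (fun T => g (insert a T))
      (fun T T' h1 h2 => hf _ _ (Finset.insert_subset_insert a h1) (Finset.insert_subset_insert a h2))
      (fun T T' h1 h2 => hg _ _ (Finset.insert_subset_insert a h1) (Finset.insert_subset_insert a h2))
    have hF : ∑ T ∈ A'.powerset, f T ≤ ∑ T ∈ A'.powerset, f (insert a T) :=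
      Finset.sum_le_sum (fun T hT => hf T (insert a T) (Finset.subset_insert a T)
        (Finset.insert_subset_insert a (Finset.mem_powerset.1 hT)))
    have hG : ∑ T ∈ A'.powerset, g T ≤ ∑ T ∈ A'.powerset, g (insert a T) :=
      Finset.sum_le_sum (fun T hT => hg T (insert a T) (Finset.subset_insert a T)
        (Finset.insert_subset_insert a (Finset.mem_powerset.1 hT)))
    have hpos : (0 : ℤ) < 2 ^ A'.card := pow_pos two_pos _
    nlinarith [h0, h1, hF, hG, mul_nonneg (sub_nonneg.2 hF) (sub_nonneg.2 hG), hpos]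

omit [Fintype V] in
/-- The Harris step: an increasing `D` with total `0` against a decreasing `S` sums to `≤ 0`. -/
lemma sum_mul_nonpos_of_monotone_antitone (A : Finset V) (D S : Finset V → ℤ)
    (hD : ∀ T T', T ⊆ T' → T' ⊆ A → D T ≤ D T') (hS : ∀ T T', T ⊆ T' → T' ⊆ A → S T' ≤ S T)
    (h0 : ∑ T ∈ A.powerset, D T = 0) : ∑ T ∈ A.powerset, D T * S T ≤ 0 := by
  have h := harris_powerset A D (fun T => -S T) hD (fun T T' h1 h2 => by
    have := hS T T' h1 h2
    linarith)
  rw [h0, zero_mul] at h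
  have hpos : (0 : ℤ) < 2 ^ A.card := pow_pos two_pos _
  have : ∑ T ∈ A.powerset, D T * (-S T) = -∑ T ∈ A.powerset, D T * S T := by
    rw [← Finset.sum_neg_distrib]
    exact Finset.sum_congr rfl (fun T _ => by ring)
  rw [this] at h
  nlinarith

omit [Fintype V] in
/-- Reindexing the powerset sum by the complement in `A`. -/
lemma sum_powerset_sdiff (A : Finset V) (f : Finset V → ℤ) :
    ∑ T ∈ A.powerset, f (A \ T) = ∑ T ∈ A.powerset, f T := by
  refine Finset.sum_nbij' (fun T => A \ T) (fun T => A \ T) ?_ ?_ ?_ ?_ ?_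
  · intro T _; exact Finset.mem_powerset.2 Finset.sdiff_subset
  · intro T _; exact Finset.mem_powerset.2 Finset.sdiff_subset
  · intro T hT; exact Finset.sdiff_sdiff_eq_self (Finset.mem_powerset.1 hT)
  · intro T hT; exact Finset.sdiff_sdiff_eq_self (Finset.mem_powerset.1 hT)
  · intro T _; rfl

/-- `1[P] ≤ 1[Q]` when `P → Q`. -/
lemma ite_le_ite_of_imp {P Q : Prop} {dP : Decidable P} {dQ : Decidable Q} (h : P → Q) :
    (@ite _ P dP (1 : ℤ) 0) ≤ @ite _ Q dQ 1 0 := by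
  split_ifs with hP hQ
  · exact le_rfl
  · exact (hQ (h hP)).elim
  · exact zero_le_one
  · exact le_rfl

/-! ## The theorem -/

variable (ends)

/-- The representative with the outside flipped. -/
noncomputable def flipO (r s : V) (ρ : Config E) : Config E := flipIn ends (Oset ends r s ρ) ρ

variable {ends}

omit [Fintype V] [DecidableEq V] [Fintype E] [DecidableEq E] in
/-- `flipO` is an involution. -/
lemma flipO_flipO (r s : V) (ρ : Config E) : flipO ends r s (flipO ends r s ρ) = ρ := by
  simp only [flipO, Oset_flipIn, flipIn_flipIn]

omit [Fintype E] [DecidableEq E] in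
/-- `A0` is preserved by `flipO`. -/
lemma A0_flipO (r s : V) (ρ : Config E) : A0 ends r s (flipO ends r s ρ) = A0 ends r s ρ :=
  A0_flipIn_Oset r s ρ

/-- `flipO` preserves the representatives. -/
lemma flipO_mem_Rep {p q r s : V} {ρ : Config E} (hρ : ρ ∈ Rep ends p q r s) :
    flipO ends r s ρ ∈ Rep ends p q r s := flipIn_mem_Rep hρ

/-- `σ_rs` of the assignment of the outside-flipped representative is `σ_rs` of the assignment. -/
lemma sigma_rs_assign_flipO {p q r s : V} {ρ : Config E} (hno : NoNonmarkEdge ends p q r s)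
    (hρ : ρ ∈ Rep ends p q r s) {T : Finset V} (hT : T ⊆ A0 ends r s ρ) :
    sigma ends (assign ends T (flipO ends r s ρ)) r s = sigma ends (assign ends T ρ) r s := by
  have h : assign ends T (flipO ends r s ρ) =
      flipIn ends (Oset ends r s (assign ends T ρ)) (assign ends T ρ) := by
    rw [Oset_assign hno (mem_Rep.1 hρ).1 hT]
    simp only [flipO, assign]
    exact (flipIn_flipTouch _ _ _).symm
  rw [h, sigma_rs_flipIn_Oset]

/-- **The per-representative identity**: `σ_pq(ρ_T) + σ_pq(ρ^O_T) = G(T) − G(A0 ∖ T)` with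
`G(T) = 1[p ~_Y q in ρ_T] + 1[p ~_Y q in ρ^O_T]`. -/
lemma sigma_pq_add_flipO {p q r s : V} {ρ : Config E} (hno : NoNonmarkEdge ends p q r s)
    (hρ : ρ ∈ Rep ends p q r s) {T : Finset V} (hT : T ⊆ A0 ends r s ρ) :
    sigma ends (assign ends T ρ) p q + sigma ends (assign ends T (flipO ends r s ρ)) p q =
      ((if Conn ends (assign ends T ρ) p q then (1 : ℤ) else 0) +
        (if Conn ends (assign ends T (flipO ends r s ρ)) p q then 1 else 0)) -
      ((if Conn ends (assign ends (A0 ends r s ρ \ T) ρ) p q then (1 : ℤ) else 0) +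
        (if Conn ends (assign ends (A0 ends r s ρ \ T) (flipO ends r s ρ)) p q then 1 else 0)) := by
  have hρO := flipO_mem_Rep hρ
  have hTO : T ⊆ A0 ends r s (flipO ends r s ρ) := by rw [A0_flipO]; exact hT
  have e1 := conn_pq_compl_assign hno hρ hT
  have e2 := conn_pq_compl_assign hno hρO hTO
  have e3 : flipIn ends (Oset ends r s (flipO ends r s ρ)) (flipO ends r s ρ) = ρ :=
    flipO_flipO r s ρ
  rw [A0_flipO, e3] at e2
  unfold sigma
  simp only [e1, e2]
  simp only [flipO]
  ring

/-- **`m9` in sign form on the class with no two non-marks adjacent and no doubly reached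
non-mark**: `Σ_{Sep} σ_pq · σ_rs ≤ 0`. -/
theorem m9SignSum_nonpos_of_noNonmarkEdge {p q r s : V} (hno : NoNonmarkEdge ends p q r s)
    (hD : ∀ ω, sep2 ends p q r s ω → DZero ends r s ω) : m9SignSum ends p q r s ≤ 0 := by
  -- the sum over `Sep`, fibred over the representatives
  have hsum : m9SignSum ends p q r s =
      ∑ ρ ∈ Rep ends p q r s, ∑ T ∈ (A0 ends r s ρ).powerset,
        sigma ends (assign ends T ρ) p q * sigma ends (assign ends T ρ) r s := by
    rw [m9SignSum, ← Finset.sum_filter]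
    exact sum_sep_eq_sum_rep hno hD (fun ω => sigma ends ω p q * sigma ends ω r s)
  -- the same sum with the representatives outside-flipped
  have hsumO : (∑ ρ ∈ Rep ends p q r s, ∑ T ∈ (A0 ends r s ρ).powerset,
        sigma ends (assign ends T ρ) p q * sigma ends (assign ends T ρ) r s) =
      ∑ ρ ∈ Rep ends p q r s, ∑ T ∈ (A0 ends r s ρ).powerset,
        sigma ends (assign ends T (flipO ends r s ρ)) p q * sigma ends (assign ends T ρ) r s := by
    symm
    refine Finset.sum_nbij' (fun ρ => flipO ends r s ρ) (fun ρ => flipO ends r s ρ)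
      (fun ρ hρ => flipO_mem_Rep hρ) (fun ρ hρ => flipO_mem_Rep hρ)
      (fun ρ _ => flipO_flipO r s ρ) (fun ρ _ => flipO_flipO r s ρ) ?_
    intro ρ hρ
    rw [A0_flipO]
    refine Finset.sum_congr rfl (fun T hT => ?_)
    rw [sigma_rs_assign_flipO hno hρ (Finset.mem_powerset.1 hT)]
  -- twice the sum is the Harris sum
  have hkey : ∀ ρ ∈ Rep ends p q r s,
      ∑ T ∈ (A0 ends r s ρ).powerset,
        (sigma ends (assign ends T ρ) p q + sigma ends (assign ends T (flipO ends r s ρ)) p q) *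
          sigma ends (assign ends T ρ) r s ≤ 0 := by
    intro ρ hρ
    set A := A0 ends r s ρ with hA
    let Yc : Finset V → ℤ := fun T => if Conn ends (assign ends T ρ) p q then 1 else 0
    let Yc' : Finset V → ℤ := fun T =>
      if Conn ends (assign ends T (flipO ends r s ρ)) p q then 1 else 0
    let G : Finset V → ℤ := fun T => Yc T + Yc' T
    let D : Finset V → ℤ := fun T => G T - G (A \ T)
    let S : Finset V → ℤ := fun T => sigma ends (assign ends T ρ) r s
    have hρO := flipO_mem_Rep hρ
    have hmonoYc : ∀ T T', T ⊆ T' → T' ⊆ A → Yc T ≤ Yc T' := by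
      intro T T' hTT hT'
      simp only [Yc]
      split_ifs with h1 h2
      · exact le_rfl
      · exact (h2 (conn_pq_assign_mono hno hρ hTT hT' h1)).elim
      · exact zero_le_one
      · exact le_rfl
    have hmonoYc' : ∀ T T', T ⊆ T' → T' ⊆ A → Yc' T ≤ Yc' T' := by
      intro T T' hTT hT'
      have hT'O : T' ⊆ A0 ends r s (flipO ends r s ρ) := by rw [A0_flipO]; exact hT'
      simp only [Yc']
      split_ifs with h1 h2
      · exact le_rfl
      · exact (h2 (conn_pq_assign_mono hno hρO hTT hT'O h1)).elim
      · exact zero_le_one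
      · exact le_rfl
    have hmonoD : ∀ T T', T ⊆ T' → T' ⊆ A → D T ≤ D T' := by
      intro T T' hTT hT'
      have h1 := hmonoYc T T' hTT hT'
      have h2 := hmonoYc' T T' hTT hT'
      have h3 := hmonoYc (A \ T') (A \ T) (Finset.sdiff_subset_sdiff (Finset.Subset.refl A) hTT)
        Finset.sdiff_subset
      have h4 := hmonoYc' (A \ T') (A \ T) (Finset.sdiff_subset_sdiff (Finset.Subset.refl A) hTT)
        Finset.sdiff_subset
      simp only [D, G]
      linarith
    have hantiS : ∀ T T', T ⊆ T' → T' ⊆ A → S T' ≤ S T := by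
      intro T T' hTT hT'
      show sigma ends (assign ends T' ρ) r s ≤ sigma ends (assign ends T ρ) r s
      unfold sigma
      exact sub_le_sub (ite_le_ite_of_imp (conn_rs_assign_anti hno hρ hTT hT'))
        (ite_le_ite_of_imp (conn_rs_compl_assign_mono hno hρ hTT hT'))
    have h0 : ∑ T ∈ A.powerset, D T = 0 := by
      simp only [D]
      rw [Finset.sum_sub_distrib, sum_powerset_sdiff, sub_self]
    have hH := sum_mul_nonpos_of_monotone_antitone A D S hmonoD hantiS h0
    refine le_trans (le_of_eq ?_) hH
    refine Finset.sum_congr rfl (fun T hT => ?_)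
    rw [sigma_pq_add_flipO hno hρ (Finset.mem_powerset.1 hT)]
  have htwice : 2 * m9SignSum ends p q r s ≤ 0 := by
    calc 2 * m9SignSum ends p q r s
        = m9SignSum ends p q r s + m9SignSum ends p q r s := by ring
      _ = (∑ ρ ∈ Rep ends p q r s, ∑ T ∈ (A0 ends r s ρ).powerset,
            sigma ends (assign ends T ρ) p q * sigma ends (assign ends T ρ) r s) +
          ∑ ρ ∈ Rep ends p q r s, ∑ T ∈ (A0 ends r s ρ).powerset,
            sigma ends (assign ends T (flipO ends r s ρ)) p q * sigma ends (assign ends T ρ) r s := by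
          rw [← hsumO, ← hsum]
      _ = ∑ ρ ∈ Rep ends p q r s, ∑ T ∈ (A0 ends r s ρ).powerset,
            (sigma ends (assign ends T ρ) p q + sigma ends (assign ends T (flipO ends r s ρ)) p q) *
              sigma ends (assign ends T ρ) r s := by
          rw [← Finset.sum_add_distrib]
          refine Finset.sum_congr rfl (fun ρ _ => ?_)
          rw [← Finset.sum_add_distrib]
          refine Finset.sum_congr rfl (fun T _ => ?_)
          ring
      _ ≤ 0 := Finset.sum_nonpos (fun ρ hρ => hkey ρ hρ)
  linarith

/-! ## The class: every non-mark adjacent to `p` or `q` -/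

omit [Fintype V] [DecidableEq V] [Fintype E] [DecidableEq E] in
/-- A non-mark adjacent to `p` or `q` is never in both worlds of `{r, s}` under `Sep`: its
attaching edge would carry `p` or `q` into one of them. -/
lemma DZero_of_adj {p q r s : V}
    (hadj : ∀ x, Nonmark p q r s x → ∃ e, ends e = s(x, p) ∨ ends e = s(x, q))
    {ω : Config E} (h : sep2 ends p q r s ω) : DZero ends r s ω := by
  intro x hr hs hK hM
  obtain ⟨e, he⟩ := hadj x (nonmark_of_mem_U2 h (Or.inl hK) hr hs)
  obtain ⟨hpK, hqK⟩ := not_mem_K2_of_sep2 h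
  obtain ⟨hpM, hqM⟩ := not_mem_M2_of_sep2 h
  rcases he with he | he
  · cases hc : ω e
    · exact hpM (mem_M2_of_closed hM hc he)
    · exact hpK (mem_K2_of_open hK hc he)
  · cases hc : ω e
    · exact hqM (mem_M2_of_closed hM hc he)
    · exact hqK (mem_K2_of_open hK hc he)

/-- **`m9` in sign form on the class «every non-mark is adjacent to `p` or `q`, and no two
non-marks are adjacent»**: `Σ_{Sep} σ_pq · σ_rs ≤ 0` (`proofs/P3-CPNC.md` §14i ∩ §15g, Phase A). -/
theorem m9SignSum_nonpos_of_adj {p q r s : V} (hno : NoNonmarkEdge ends p q r s)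
    (hadj : ∀ x, Nonmark p q r s x → ∃ e, ends e = s(x, p) ∨ ends e = s(x, q)) :
    m9SignSum ends p q r s ≤ 0 :=
  m9SignSum_nonpos_of_noNonmarkEdge hno (fun _ h => DZero_of_adj hadj h)

omit [Fintype V] [DecidableEq V] [Fintype E] [DecidableEq E] in
/-- A pendant vertex (a single edge) is reached from `{r, s}` in at most one colour. -/
lemma not_mem_both_of_pendant {r s x : V} {e₁ : E} (hp : Pendant ends x e₁) (hr : x ≠ r)
    (hs : x ≠ s) {ω : Config E} (hK : x ∈ K2 ends r s ω) (hM : x ∈ M2 ends r s ω) : False := by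
  cases hc : ω e₁
  · have hcl : ∀ e, x ∈ ends e → ω e = false := fun e he => by rw [hp.1 e he]; exact hc
    rcases mem_K2_iff.1 hK with h | h
    · exact hr (eq_of_conn_of_no_openEdge hcl h).symm
    · exact hs (eq_of_conn_of_no_openEdge hcl h).symm
  · have hcl : ∀ e, x ∈ ends e → OneColourSwitch.compl ω e = false := fun e he => by
      simp [OneColourSwitch.compl, hp.1 e he, hc]
    rcases mem_M2_iff.1 hM with h | h
    · exact hr (eq_of_conn_of_no_openEdge hcl h).symm
    · exact hs (eq_of_conn_of_no_openEdge hcl h).symm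

omit [Fintype V] [DecidableEq V] [Fintype E] [DecidableEq E] in
/-- A non-mark adjacent to `p` or `q`, or pendant, is never in both worlds under `Sep`. -/
lemma DZero_of_adj_or_pendant {p q r s : V}
    (hadj : ∀ x, Nonmark p q r s x →
      (∃ e, ends e = s(x, p) ∨ ends e = s(x, q)) ∨ ∃ e₁, Pendant ends x e₁)
    {ω : Config E} (h : sep2 ends p q r s ω) : DZero ends r s ω := by
  intro x hr hs hK hM
  obtain ⟨hpK, hqK⟩ := not_mem_K2_of_sep2 h
  obtain ⟨hpM, hqM⟩ := not_mem_M2_of_sep2 h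
  rcases hadj x (nonmark_of_mem_U2 h (Or.inl hK) hr hs) with ⟨e, he | he⟩ | ⟨e₁, hp⟩
  · cases hc : ω e
    · exact hpM (mem_M2_of_closed hM hc he)
    · exact hpK (mem_K2_of_open hK hc he)
  · cases hc : ω e
    · exact hqM (mem_M2_of_closed hM hc he)
    · exact hqK (mem_K2_of_open hK hc he)
  · exact not_mem_both_of_pendant hp hr hs hK hM

/-- **`m9` in sign form on the class «every non-mark is adjacent to `p` or `q` or is pendant,
and no two non-marks are adjacent»** (`proofs/P3-CPNC.md` §14i ∪ §14o, Phase A of §15g). -/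
theorem m9SignSum_nonpos_of_adj_or_pendant {p q r s : V} (hno : NoNonmarkEdge ends p q r s)
    (hadj : ∀ x, Nonmark p q r s x →
      (∃ e, ends e = s(x, p) ∨ ends e = s(x, q)) ∨ ∃ e₁, Pendant ends x e₁) :
    m9SignSum ends p q r s ≤ 0 :=
  m9SignSum_nonpos_of_noNonmarkEdge hno (fun _ h => DZero_of_adj_or_pendant hadj h)

end Count

end SideSwitch

end Summit.Ventures.PercRepro2
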